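import Summits.BirchSwinnertonDyer.Rank1Residual.Additive.ChiBranchRatLowerDvdUnitRows
import Summits.BirchSwinnertonDyer.Rank1Residual.Additive.ChiBranchRatLowerDvd
import HarnessLib

/-!
# Unit-row discharge, EVEN branch (`p ≡ 1 (mod 4)`): on the UNIT rows the one-sided node
# `ChiBranchRatLowerDvdAt` — hence the rational branch main conjecture `ChiBranchRatCharEqAt` — is a
# THEOREM from Kato's printed half alone (even twin of `ChiBranchRatLowerDvdUnitRows.lean`)
# (cell `b2b-bsdres`, team n1011, seat n1011-p06 gen 2, OWNERS row T-N10R, phase 4, unit rows, even)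

HONEST FRAMING (cell `b2b-bsdres`, run/shared/lean/b2b/bsd-rank1-residual/, verbatim in every
file): the goal of the cell is to DELETE the COMBINATION-SHAPED residual classes of the
Birch–Swinnerton-Dyer formula for ALL analytic-rank `≤ 1` elliptic curves over `ℚ` — "full BSD
formula for every rank `≤ 1` curve in class `C`" assembled STRICTLY from published theorems — so
that the rank-`≤ 1` remainder becomes exactly the CONSTRUCTION-SHAPED classes, which are TYPED
(missing-input `Prop`s), NOT attempted. This is not "finishing BSD". Team n1011 (X4 ∧ `p = 3` / the
additive block, §I items N10 / N11): research routes; prove what is provable now; no claim beyond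
the stated classes; X4♯(G-ord) stays CONSTRUCTION-SHAPED; labels / census / located gap UNCHANGED;
nothing is booked. Theorems only (no definition, no named fact minted; the Literature input is the
explicit binder `hKW` = the Kato/Wuthrich half-eigenspace reading).

## What and why

Even twin of `ChiBranchRatLowerDvdUnitRows.lean` §1 (same seat): on a UNIT row (`L(E,1) = q·Ω_E`,
`ord_p q = 0`) at `p ≡ 1 (mod 4)` the constant term of the Néron-normalised even branch
`ϖ · L_p(f♭, α♭, ω^{(p−1)/2}, T)` of the good-ordinary twist is `ϖ·α♭⁻¹·∑(a/p)[a/p]⁺_f` with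
`ϖ·∑(…) = L(E,1)/Ω_E = q` (census-ctyper1's `CensusX41.norm_coeff_zero_even`: MTT (10.1)/(13) + the
even Birch/Pal identity, PROVED), so Kato's element `g₁ ∈ char_Λ X(E/ℚ_∞)` with `ι g₁ = u·ϖ L_p` is a
unit of `Λ`, `char_Λ X = Λ`, and the node `ChiBranchRatLowerDvdAt W p` holds with `G = u⁻¹ g₁`,
`m = n = 0`; by the split (`chiBranchRatCharEqAt_of_katoHalf_of_ratLowerDvd`, p253092) the rational
even-branch main conjecture `ChiBranchRatCharEqAt W p` is then a THEOREM on the unit rows. This is the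
`λ^{an} = 0` instance of ROUTE-2 II.9's mechanism on the even branch; nothing of T-E3d is written.
Nothing booked; no label change.

References: K. Kato, Astérisque 295 (2004) Thm. 17.4 (3) (p. 273) [Kato2004Asterisque];
Mazur–Tate–Teitelbaum, Invent. Math. 84 (1986) §I.10 (10.1), §I.13 [MazurTateTeitelbaum1986Invent];
A. Pal, Proc. AMS (2012) Thm. 3.2 [Pal2012]; C. Skinner, E. Urban, Invent. Math. 195 (2014) Thm. 3.6.4
(p. 43) [SkinnerUrban2014].
-/

noncomputable section

open scoped Classical MatrixGroups ModularForm NumberField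

open CongruenceSubgroup WeierstrassCurve NumberField Literature.NumberTheory.EllipticCurves
  Literature.NumberTheory.EllipticCurves.ModularForms
  Literature.NumberTheory.EllipticCurves.Rank1Residual
  Literature.NumberTheory.EllipticCurves.Rank1Residual.Typed
  Literature.NumberTheory.GaloisRepresentations
  IsDedekindDomain

namespace Summit.BirchSwinnertonDyer.Rank1Residual.Additive

variable {W : WeierstrassCurve ℚ} [W.IsElliptic] [W.IsGloballyMinimal] {p : ℕ} [hp : Fact p.Prime]

/-- **UNIT rows, (G-ord) even branch (`p ≡ 1 (mod 4)`): Kato's half ALONE gives the one-sided node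
`ChiBranchRatLowerDvdAt W p`.** For `W` globally minimal, additive and potentially good at `p`
(`0 ≤ ord_p j`), `ρ̄_{W,p^n}` onto for all `n`, `L(E,1) = q·Ω_E` with `q ≠ 0`, `ord_p q = 0`: Kato's
`g₁ ∈ char_Λ X(E/ℚ_∞)` with `ι g₁ = u·ϖ·L_p(f♭, α♭, ω^{(p−1)/2}, T)` has unit constant term
(`‖(ϖ L_p)(0)‖ = ‖ϖ·∑(a/p)[a/p]⁺_f‖ = ‖q‖ = 1`, `CensusX41.norm_coeff_zero_even`), so `(u⁻¹ g₁) = Λ`.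
[cite: Kato2004Asterisque, Thm. 17.4 (3) (p. 273)] [cite: MazurTateTeitelbaum1986Invent, §I.10 (10.1), §I.13]
[cite: Pal2012, Thm. 3.2] -/
theorem chiBranchRatLowerDvdAt_of_katoHalf_of_unitLValue
    (hKW : Wuthrich2014.kato_halfEigenCharIdeal_dvd_cyclotomicPrime_of_surjective)
    (hmod : hasEntireLFunction_rat) (hj : 0 ≤ padicValRat p W.j)
    (htower : ∀ n : ℕ, W.HasSurjectiveModNGaloisRep (p ^ n : ℕ)) (hadd : Addv W p)
    {q : ℚ} (hq : W.entireLFunction 1 = (q : ℂ) * (W.realPeriodRat : ℂ)) (hq0 : q ≠ 0)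
    (hv : padicValRat p q = 0) :
    ChiBranchRatLowerDvdAt W p := by
  intro V _ _ κ γ N _ f hp1 hCW hV hκ hγ hcv hf D ϖ hϖ g _hg
  have hpne : (p : ℚ) ≠ 0 := Nat.cast_ne_zero.mpr hp.out.ne_zero
  have hsurjV : ∀ n : ℕ, V.HasSurjectiveModNGaloisRep (p ^ n : ℕ) := fun n ↦
    (GaloisImage.hasSurjectiveModNGaloisRep_pow_iff_of_model_twist V p hpne hCW n).mp (htower n)
  -- Kato's element
  obtain ⟨-, g₁, -, u, hιg₁⟩ :=
    exists_mem_charIdeal_map_eq_unit_mul_branch_of_katoHalf W p hKW hj V hp1 hCW (Or.inl hV) hsurjV hκ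
      hγ hcv hf D ϖ hϖ
  have hCu : iwasawaToPowerSeries p (PowerSeries.C ((u⁻¹ : ℤ_[p]ˣ) : ℤ_[p])) =
      PowerSeries.C ((((u⁻¹ : ℤ_[p]ˣ) : ℤ_[p]) : ℚ_[p])) := by
    rw [PowerSeries.map_C, PadicInt.algebraMap_apply]
  have hu0 : (((u : ℤ_[p]) : ℚ_[p])) ≠ 0 := by
    intro h0
    have h1 : (((u⁻¹ : ℤ_[p]ˣ) : ℤ_[p]) : ℚ_[p]) * (((u : ℤ_[p]) : ℚ_[p])) = 1 := by
      rw [← PadicInt.coe_mul, Units.inv_mul, PadicInt.coe_one]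
    rw [h0, mul_zero] at h1
    exact zero_ne_one h1
  have hιG : iwasawaToPowerSeries p (PowerSeries.C ((u⁻¹ : ℤ_[p]ˣ) : ℤ_[p]) * g₁) =
      PowerSeries.C (ϖ : ℚ_[p]) * padicLFunctionBranch f (unitRoot V p : ℚ_[p]) (p / 2) := by
    rw [map_mul, hιg₁, hCu, ← mul_assoc, ← map_mul, coe_units_inv_eq_inv, ← mul_assoc,
      inv_mul_cancel₀ hu0, one_mul]
  -- the constant term of `ϖ L_p` is `ϖ S⁺ = q`, a unit
  obtain ⟨C, hC⟩ := hCW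
  have hord : IsOrdinaryAt V p := (isOrdinaryAt_iff V p).mpr ⟨hV.1, hV.2⟩
  obtain ⟨hnorm, hL⟩ := CensusX41.norm_coeff_zero_even p hmod hp1 V W C hC hord hadd hf ϖ hϖ
  have hΩ : (W.realPeriodRat : ℂ) ≠ 0 := by exact_mod_cast W.realPeriodRat_pos_holds.ne'
  have hqS : ϖ * legendrePlusSymbolSum f p = q := by
    have h : ((ϖ * legendrePlusSymbolSum f p : ℚ) : ℂ) = (q : ℂ) :=
      mul_right_cancel₀ hΩ (hL.symm.trans hq)
    exact_mod_cast h
  have h1 : ‖PowerSeries.constantCoeff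
      (PowerSeries.C (ϖ : ℚ_[p]) * padicLFunctionBranch f (unitRoot V p : ℚ_[p]) (p / 2))‖ = 1 := by
    rw [← PowerSeries.coeff_zero_eq_constantCoeff_apply, hnorm, hqS]
    exact norm_ratCast_padic_eq_one_of_padicValRat_eq_zero p hq0 hv
  refine ⟨PowerSeries.C ((u⁻¹ : ℤ_[p]ˣ) : ℤ_[p]) * g₁, 0, 0, ?_, ?_⟩
  · rw [span_singleton_eq_top_of_map_eq_of_norm_constantCoeff_eq_one p hιG h1]
    exact Submodule.mem_top
  · rw [pow_zero, map_one, one_mul, hιG]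

/-- **UNIT rows, (G-ord) even branch: the rational `ω^{(p−1)/2}`-branch main conjecture
`ChiBranchRatCharEqAt W p` is a THEOREM from Kato's half** (node + split
`chiBranchRatCharEqAt_of_katoHalf_of_ratLowerDvd`). [cite: Kato2004Asterisque, Thm. 17.4 (3) (p. 273)]
[cite: SkinnerUrban2014, Thm. 3.6.4, proof (p. 43)] -/
theorem chiBranchRatCharEqAt_of_katoHalf_of_unitLValue
    (hKW : Wuthrich2014.kato_halfEigenCharIdeal_dvd_cyclotomicPrime_of_surjective)
    (hmod : hasEntireLFunction_rat) (hj : 0 ≤ padicValRat p W.j)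
    (htower : ∀ n : ℕ, W.HasSurjectiveModNGaloisRep (p ^ n : ℕ)) (hadd : Addv W p)
    {q : ℚ} (hq : W.entireLFunction 1 = (q : ℂ) * (W.realPeriodRat : ℂ)) (hq0 : q ≠ 0)
    (hv : padicValRat p q = 0) :
    ChiBranchRatCharEqAt W p :=
  chiBranchRatCharEqAt_of_katoHalf_of_ratLowerDvd hKW hj htower
    (chiBranchRatLowerDvdAt_of_katoHalf_of_unitLValue hKW hmod hj htower hadd hq hq0 hv)

/-- **X4♯(G-ord) ∩ surj(p), `p ≥ 5`, UNIT rows (even branch rows when `p ≡ 1 (mod 4)`): the rational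
even-branch main conjecture is a THEOREM** (tower from surj(p) by Serre, PROVED).
[cite: Kato2004Asterisque, Thm. 17.4 (3) (p. 273)] [cite: SerreAbelianLadic1968, Ch. IV §3.4, Lemma 3 (IV-23)] -/
theorem ClassX4Gord.chiBranchRatCharEqAt_of_katoHalf_of_unitLValue_of_surj
    (hKW : Wuthrich2014.kato_halfEigenCharIdeal_dvd_cyclotomicPrime_of_surjective)
    (hmod : hasEntireLFunction_rat) (hX : ClassX4Gord W p) (hp5 : 5 ≤ p) (hsurj : Surj W p)
    {q : ℚ} (hq : W.entireLFunction 1 = (q : ℂ) * (W.realPeriodRat : ℂ)) (hq0 : q ≠ 0)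
    (hv : padicValRat p q = 0) :
    ChiBranchRatCharEqAt W p :=
  chiBranchRatCharEqAt_of_katoHalf_of_unitLValue hKW hmod (padicValRat_j_nonneg_of_typeGOrd W p hX.typeGOrd)
    (W.forall_hasSurjectiveModNGaloisRep_pow_of_surj_of_five_le_or_semistable p hX.addv.1 (Or.inl hp5)
      hsurj) hX.addv.2 hq hq0 hv

end Summit.BirchSwinnertonDyer.Rank1Residual.Additive

end
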